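import Summits.ABC.ABC.Theses.TwistAmplification
import Literature.NumberTheory.EllipticCurves.QuadraticTwistMinimalModelProofs
import Literature.NumberTheory.EllipticCurves.SzpiroLocalDataProofs
import Literature.NumberTheory.EllipticCurves.SzpiroFreyProofs
import Literature.NumberTheory.DiophantineGeometry.ConductorExponentLeTwoProofs

/-!
# Route TwistAmplification — `QuadraticTwistInvariants` (stmt-ABC-1977) = stub Q of line
# `polynomial-degree-suffices` for crux `SomeWindowSaving` (stmt-ABC-1976)

Tate's algorithm for the quadratic twist of a global minimal model `W₀/ℤ` by a squarefree
`d ≡ 1 (mod 4)` coprime to `6N`: the integral twist model `W₁ := W₀.twistModel k` (`d = 4k+1`,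
`Literature…QuadraticTwistIntegralModel`) is minimal at every prime, has `Δ ↦ d⁶Δ`,
`c₄ ↦ d²c₄`, is `ℚ`-isomorphic to `(W₀ ⊗ ℚ).quadraticTwist d`, and has conductor `N·d²`: at
`p ∤ d` the twist is unramified (`isMinimalAt_twistModel`, `conductorExponent_twistModel`), at
`p ∣ d` (`p ≥ 5`, `p ∤ N`, so `W₀` has good reduction and `v_p(Δ₁) = 6 < 12`) the model is
minimal and additive with `f_p = 2` (`two_le_conductorExponent_of_dvd_Δ_of_dvd_c₄`,
`conductorExponent_le_two_of_five_le_natGenerator_holds`).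
Silverman AEC VII.1, X.5; ATAEC IV.9–10; Connell §4.3; Comalada 1994.
-/

-- `Summit.<Summit>.<Problem>` is the mandated summit-side namespace (CONVENTIONS §2); for the
-- single-conjunct summit `ABC` the two coincide, so the duplicate `ABC.ABC` is deliberate.
set_option linter.dupNamespace false

namespace Summit.ABC.ABC.Theorems

open WeierstrassCurve IsDedekindDomain Rat.HeightOneSpectrum
open Literature.NumberTheory.EllipticCurves

namespace QuadraticTwistInvariants

/-- A prime dividing `d` with `(d, 6N) = 1` does not divide `6N`. [folklore] -/
theorem not_dvd_of_isCoprime {d : ℤ} {N p : ℕ} (hcop : IsCoprime d (6 * (N : ℤ)))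
    (hp : p.Prime) (hpd : (p : ℤ) ∣ d) : ¬ p ∣ 6 * N := fun h ↦
  hp.ne_one (Nat.isUnit_iff.mp (Int.ofNat_isUnit.mp
    (hcop.isUnit_of_dvd' hpd (by exact_mod_cast h))))

variable {W₀ : WeierstrassCurve ℤ} {k : ℤ}

/-- The twist model of a model of an elliptic curve is a model of an elliptic curve (`Δ ↦ d⁶Δ`,
`d = 4k+1 ≠ 0`). [folklore] -/
theorem isElliptic_twistModel [(W₀.baseChange ℚ).IsElliptic] (hd : (4 * k + 1 : ℤ) ≠ 0) :
    ((W₀.twistModel k).baseChange ℚ).IsElliptic := by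
  refine ⟨?_⟩
  rw [baseChange_int_Δ, twistModel_Δ, isUnit_iff_ne_zero]
  exact_mod_cast mul_ne_zero (pow_ne_zero 6 hd) (Δ_ne_zero_of_isElliptic_baseChange_int W₀)

/-- The twist by `d = 4k+1` is unramified at a place `v ∤ d`: `|k|_v ≤ 1` and `|4k+1|_v = 1`.
[folklore] -/
theorem valuation_twist_param (v : HeightOneSpectrum ℤ)
    (hv : ¬ (natGenerator v : ℤ) ∣ 4 * k + 1) :
    v.valuation ℚ (k : ℚ) ≤ 1 ∧ v.valuation ℚ (4 * (k : ℚ) + 1) = 1 := by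
  rw [show (4 * (k : ℚ) + 1) = ((4 * k + 1 : ℤ) : ℚ) by push_cast; ring,
    show (k : ℚ) = algebraMap ℤ ℚ k from (eq_intCast _ k).symm]
  exact ⟨HeightOneSpectrum.valuation_le_one v k,
    (Literature.NumberTheory.EllipticCurves.Rat.valuation_intCast_eq_one_iff v _).mpr hv⟩

/-- Minimality of the twist model at a place not dividing `d = 4k+1` (unramified twist).
[folklore] -/
theorem isMinimalAt_twistModel_of_not_dvd (v : HeightOneSpectrum ℤ)
    (hmin : (W₀.baseChange ℚ).IsMinimalAt v) (hv : ¬ (natGenerator v : ℤ) ∣ 4 * k + 1) :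
    ((W₀.twistModel k).baseChange ℚ).IsMinimalAt v := by
  rw [show (W₀.twistModel k).baseChange ℚ = (W₀.baseChange ℚ).twistModel (k : ℚ) by
    simp only [baseChange, map_twistModel, eq_intCast]]
  exact isMinimalAt_twistModel v _ hmin (valuation_twist_param v hv).1
    (valuation_twist_param v hv).2

/-- Conductor exponent of the twist model at a place not dividing `d = 4k+1`: unchanged.
[folklore] -/
theorem conductorExponent_twistModel_of_not_dvd [(W₀.baseChange ℚ).IsElliptic]
    (v : HeightOneSpectrum ℤ) (hv : ¬ (natGenerator v : ℤ) ∣ 4 * k + 1) :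
    ((W₀.twistModel k).baseChange ℚ).conductorExponent v =
      (W₀.baseChange ℚ).conductorExponent v := by
  rw [show (W₀.twistModel k).baseChange ℚ = (W₀.baseChange ℚ).twistModel (k : ℚ) by
    simp only [baseChange, map_twistModel, eq_intCast]]
  exact conductorExponent_twistModel v _ (valuation_twist_param v hv).1
    (valuation_twist_param v hv).2

/-- A prime not dividing the conductor does not divide the discriminant of a model minimal at it
(good reduction). [folklore] -/
theorem not_dvd_Δ_of_not_dvd_conductorNorm [(W₀.baseChange ℚ).IsElliptic]
    {v : HeightOneSpectrum ℤ} (hmin : (W₀.baseChange ℚ).IsMinimalAt v)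
    (hN : ¬ (natGenerator v : ℕ) ∣ (W₀.baseChange ℚ).conductorNorm ℤ) :
    ¬ (natGenerator v : ℤ) ∣ W₀.Δ := by
  intro hΔ
  apply conductorExponent_ne_zero_of_dvd_Δ hmin hΔ
  have hf := factorization_conductorNorm_primesEquiv_symm (W₀.baseChange ℚ) (primesEquiv v)
  rw [Equiv.symm_apply_apply] at hf
  rw [← hf]
  exact Nat.factorization_eq_zero_of_not_dvd hN

/-- For a squarefree `d` and a prime `p`, `p¹² ∤ d⁶ m` whenever `p ∤ m`. [folklore] -/
theorem not_pow_twelve_dvd {p d m : ℤ} (hp : Prime p) (hsq : Squarefree d) (hm : ¬ p ∣ m) :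
    ¬ p ^ 12 ∣ d ^ 6 * m := by
  intro h
  have h6 : p ^ 12 ∣ d ^ 6 := hp.pow_dvd_of_dvd_mul_right 12 hm h
  -- `p² ∣ d` would follow, contradicting squarefreeness
  have hp2 : ¬ p * p ∣ d := fun h2 ↦ hp.not_unit (hsq p h2)
  by_cases hpd : p ∣ d
  · obtain ⟨e, rfl⟩ := hpd
    have he : ¬ p ∣ e := fun he ↦ hp2 (mul_dvd_mul_left p he)
    have h' : p ^ 6 * p ^ 6 ∣ p ^ 6 * e ^ 6 := by
      simpa only [mul_pow, show (12 : ℕ) = 6 + 6 from rfl, pow_add] using h6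
    have h'' : p ^ 6 ∣ e ^ 6 := (mul_dvd_mul_iff_left (pow_ne_zero 6 hp.ne_zero)).mp h'
    exact he (hp.dvd_of_dvd_pow (dvd_trans (dvd_pow_self p (by norm_num)) h''))
  · exact hpd (hp.dvd_of_dvd_pow (dvd_trans (dvd_pow_self p (by norm_num)) h6))

/-- Minimality of the twist model at a prime `p ∣ d` not dividing the conductor:
`v_p(Δ₁) = 6 < 12`. [folklore] -/
theorem isMinimalAt_twistModel_of_dvd [(W₀.baseChange ℚ).IsElliptic] (v : HeightOneSpectrum ℤ)
    (hmin : (W₀.baseChange ℚ).IsMinimalAt v) (hsq : Squarefree (4 * k + 1))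
    (hN : ¬ (natGenerator v : ℕ) ∣ (W₀.baseChange ℚ).conductorNorm ℤ) :
    ((W₀.twistModel k).baseChange ℚ).IsMinimalAt v := by
  refine isMinimalAt_baseChange_int_of_not_pow_dvd_Δ ?_
  rw [twistModel_Δ]
  exact not_pow_twelve_dvd (Nat.prime_iff_prime_int.mp (prime_natGenerator v)) hsq
    (not_dvd_Δ_of_not_dvd_conductorNorm hmin hN)

/-- Minimality of the twist model everywhere (squarefree `d = 4k+1` coprime to `6N`).
[folklore] -/
theorem isMinimalAt_twistModel_all [(W₀.baseChange ℚ).IsElliptic]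
    (hmin : ∀ v : HeightOneSpectrum ℤ, (W₀.baseChange ℚ).IsMinimalAt v)
    (hsq : Squarefree (4 * k + 1))
    (hcop : IsCoprime (4 * k + 1) (6 * ((W₀.baseChange ℚ).conductorNorm ℤ : ℤ)))
    (v : HeightOneSpectrum ℤ) : ((W₀.twistModel k).baseChange ℚ).IsMinimalAt v := by
  by_cases hv : (natGenerator v : ℤ) ∣ 4 * k + 1
  · exact isMinimalAt_twistModel_of_dvd v (hmin v) hsq fun h ↦
      not_dvd_of_isCoprime hcop (prime_natGenerator v) hv (dvd_mul_of_dvd_right h _)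
  · exact isMinimalAt_twistModel_of_not_dvd v (hmin v) hv

/-- Conductor exponent `2` of the twist model at a prime `p ≥ 5` dividing `d` and not the
conductor (additive, potentially good of type `I₀*`). [folklore] -/
theorem conductorExponent_twistModel_of_dvd [(W₀.baseChange ℚ).IsElliptic]
    (v : HeightOneSpectrum ℤ) (hmin : (W₀.baseChange ℚ).IsMinimalAt v)
    (hsq : Squarefree (4 * k + 1)) (hv : (natGenerator v : ℤ) ∣ 4 * k + 1)
    (h5 : 5 ≤ natGenerator v) (hN : ¬ (natGenerator v : ℕ) ∣ (W₀.baseChange ℚ).conductorNorm ℤ) :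
    ((W₀.twistModel k).baseChange ℚ).conductorExponent v = 2 := by
  haveI := isElliptic_twistModel (W₀ := W₀) hsq.ne_zero
  refine le_antisymm (conductorExponent_le_two_of_five_le_natGenerator_holds _ v h5) ?_
  refine two_le_conductorExponent_of_dvd_Δ_of_dvd_c₄
    (isMinimalAt_twistModel_of_dvd v hmin hsq hN) ?_ ?_
  · rw [twistModel_Δ]
    exact dvd_mul_of_dvd_left (dvd_pow hv (by norm_num)) _
  · rw [twistModel_c₄]
    exact dvd_mul_of_dvd_left (dvd_pow hv (by norm_num)) _

/-- The conductor of the twist model: `N(W₁) = N(W₀) · |d|²` (`d = 4k+1` squarefree, coprime to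
`6N`). [folklore] -/
theorem conductorNorm_twistModel [(W₀.baseChange ℚ).IsElliptic]
    (hmin : ∀ v : HeightOneSpectrum ℤ, (W₀.baseChange ℚ).IsMinimalAt v)
    (hsq : Squarefree (4 * k + 1))
    (hcop : IsCoprime (4 * k + 1) (6 * ((W₀.baseChange ℚ).conductorNorm ℤ : ℤ))) :
    ((W₀.twistModel k).baseChange ℚ).conductorNorm ℤ =
      (W₀.baseChange ℚ).conductorNorm ℤ * (4 * k + 1).natAbs ^ 2 := by
  haveI := isElliptic_twistModel (W₀ := W₀) hsq.ne_zero
  set N₀ := (W₀.baseChange ℚ).conductorNorm ℤ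
  have hN₀ : N₀ ≠ 0 := (conductorNorm_pos_holds _).ne'
  have hN₁ : ((W₀.twistModel k).baseChange ℚ).conductorNorm ℤ ≠ 0 := (conductorNorm_pos_holds _).ne'
  have hdn : (4 * k + 1).natAbs ≠ 0 := Int.natAbs_ne_zero.mpr hsq.ne_zero
  refine Nat.eq_of_factorization_eq hN₁ (mul_ne_zero hN₀ (pow_ne_zero 2 hdn)) fun q ↦ ?_
  by_cases hq : q.Prime
  swap
  · rw [Nat.factorization_eq_zero_of_not_prime _ hq, Nat.factorization_eq_zero_of_not_prime _ hq]
  obtain ⟨v, hv⟩ := exists_place ⟨q, hq⟩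
  have hveq : (primesEquiv (R := ℤ)).symm ⟨q, hq⟩ = v :=
    (primesEquiv (R := ℤ)).symm_apply_eq.mpr (Subtype.ext hv.symm)
  rw [Nat.factorization_mul hN₀ (pow_ne_zero 2 hdn), Nat.factorization_pow, Finsupp.add_apply,
    Finsupp.smul_apply, smul_eq_mul, show q = ((⟨q, hq⟩ : Nat.Primes) : ℕ) from rfl,
    factorization_conductorNorm_primesEquiv_symm _ ⟨q, hq⟩,
    factorization_conductorNorm_primesEquiv_symm _ ⟨q, hq⟩, hveq]
  simp only
  by_cases hqd : (q : ℤ) ∣ 4 * k + 1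
  · -- `q ∣ d`: `f_q(W₁) = 2 = 0 + 2·1`
    have hq6N : ¬ q ∣ 6 * N₀ := not_dvd_of_isCoprime hcop hq hqd
    have hqN : ¬ q ∣ N₀ := fun h ↦ hq6N (dvd_mul_of_dvd_right h _)
    have hq6 : ¬ q ∣ 6 := fun h ↦ hq6N (dvd_mul_of_dvd_left h _)
    have h5 : 5 ≤ q := by
      have h2 := hq.two_le
      by_contra h
      push Not at h
      interval_cases q
      · exact hq6 (by norm_num)
      · exact hq6 (by norm_num)
      · exact absurd hq (by norm_num)
    have hf₀ : (W₀.baseChange ℚ).conductorExponent v = 0 := by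
      have hf := factorization_conductorNorm_primesEquiv_symm (W₀.baseChange ℚ) ⟨q, hq⟩
      rw [hveq] at hf
      rw [← hf]
      exact Nat.factorization_eq_zero_of_not_dvd hqN
    have hf₁ : ((W₀.twistModel k).baseChange ℚ).conductorExponent v = 2 :=
      conductorExponent_twistModel_of_dvd v (hmin v) hsq (by rw [hv]; exact hqd)
        (by rw [hv]; exact h5) (by rw [hv]; exact hqN)
    have hdq : (4 * k + 1).natAbs.factorization q = 1 :=
      Nat.factorization_eq_one_of_squarefree (Int.squarefree_natAbs.mpr hsq) hq
        (Int.natCast_dvd.mp hqd)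
    rw [hf₁, hf₀, hdq]
  · -- `q ∤ d`: `f_q(W₁) = f_q(W₀)`, `v_q(d) = 0`
    have hdq : (4 * k + 1).natAbs.factorization q = 0 :=
      Nat.factorization_eq_zero_of_not_dvd (fun h ↦ hqd (Int.natCast_dvd.mpr h))
    rw [hdq, conductorExponent_twistModel_of_not_dvd v (by rw [hv]; exact hqd)]
    ring

end QuadraticTwistInvariants

open QuadraticTwistInvariants in
/-- **STUB Q of line `polynomial-degree-suffices` (crux `SomeWindowSaving`, stmt-ABC-1976) = the
route support `QuadraticTwistInvariants` (stmt-ABC-1977): Tate's algorithm for quadratic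
twists.**  For a global minimal model `W₀/ℤ` of an elliptic curve, `d` squarefree,
`d ≡ 1 (mod 4)`, `(d, 6N) = 1`, the integral twist model `W₁ = W₀.twistModel ((d−1)/4)` is
`ℚ`-isomorphic to the quadratic twist `(W₀ ⊗ ℚ)^{(d)}`, minimal at every place, with
`Δ(W₁) = d⁶Δ(W₀)`, `c₄(W₁) = d²c₄(W₀)` and conductor `N·d²` (`f_p` unchanged at `p ∤ d`,
`f_p = 2` — type `I₀*` — at `p ∣ d`).  Silverman AEC VII.1, X.5; ATAEC IV.9–IV.10; Connell,
*Elliptic Curve Handbook* §4.3; Comalada 1994 §2.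
[cite: SilvermanAEC2009, VII.1 Prop. 1.3 and X.5 Cor. 5.4] -/
theorem stub_quadraticTwistInvariants :
    ∀ (W₀ : WeierstrassCurve ℤ), (W₀.baseChange ℚ).IsElliptic →
      (∀ v : IsDedekindDomain.HeightOneSpectrum ℤ, (W₀.baseChange ℚ).IsMinimalAt v) →
        ∀ d : ℤ, Squarefree d → d ≡ 1 [ZMOD 4] →
          IsCoprime d (6 * ((W₀.baseChange ℚ).conductorNorm ℤ : ℤ)) →
            ∃ (W₁ : WeierstrassCurve ℤ) (e : WeierstrassCurve.VariableChange ℚ),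
              W₁.baseChange ℚ = e • (W₀.baseChange ℚ).quadraticTwist (d : ℚ) ∧
              (∀ v : IsDedekindDomain.HeightOneSpectrum ℤ, (W₁.baseChange ℚ).IsMinimalAt v) ∧
              W₁.Δ = d ^ 6 * W₀.Δ ∧ W₁.c₄ = d ^ 2 * W₀.c₄ ∧
              (W₁.baseChange ℚ).conductorNorm ℤ =
                (W₀.baseChange ℚ).conductorNorm ℤ * d.natAbs ^ 2 := by
  intro W₀ hE hmin d hsq hd4 hcop
  -- `d = 4k + 1`
  obtain ⟨k, rfl⟩ : ∃ k : ℤ, d = 4 * k + 1 := by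
    obtain ⟨c, hc⟩ := Int.modEq_iff_dvd.mp hd4.symm
    exact ⟨c, by omega⟩
  obtain ⟨C, -, hC⟩ :=
    exists_variableChange_twistModel_eq_quadraticTwist (W₀.baseChange ℚ) (k : ℚ)
  refine ⟨W₀.twistModel k, C⁻¹, ?_, isMinimalAt_twistModel_all hmin hsq hcop, twistModel_Δ _ _,
    twistModel_c₄ _ _, conductorNorm_twistModel hmin hsq hcop⟩
  rw [show (W₀.twistModel k).baseChange ℚ = (W₀.baseChange ℚ).twistModel (k : ℚ) by
    simp only [baseChange, map_twistModel, eq_intCast]]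
  push_cast
  rw [← hC, inv_smul_smul]

/-- The route support item stmt-ABC-1977 itself: `QuadraticTwistInvariants` holds (it IS the
stub). -/
theorem quadraticTwistInvariants_proof :
    Summit.ABC.ABC.Theses.TwistAmplification.QuadraticTwistInvariants :=
  stub_quadraticTwistInvariants

end Summit.ABC.ABC.Theorems
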